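import Summits.BirchSwinnertonDyer.BirchSwinnertonDyer.Theorems.ClassRecordThreeEulerHalvesAtThreeCartanPreDatumOfLattice
import HarnessLib

/-!
# Crux 19109 `EulerHalvesAtThree` ∕ 23422, line `cartan` v14, node (F2b♮): THE DEGREE FORM `B` AND ITS NORMALISATION `c` ARE FORCED (Schur) —
# a B-free, c-free constructor contract of the saturated pre-datum from any REAL invariant positive form (e.g. the Petersson form)

Seat `bsd-idea-10` g16 (ideator, lens = transfer; `--supports stmt-BirchSwinnertonDyer-19109 --as helper`; W-71: no route verb, no registration).
Companion of tam3-p1 g25's `CartanPreDatumOfLattice.saturatedDictionary_of_latticeDictionary` (p722687), which takes a `CartanTorusLattice` WITH its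
integral degree form `B`, a normalisation `c > 0` and two sheet counts `c·B(u_S,u_S) = ½(q−1)²·degX0`, `c·B(u_C,u_C) = ½(q²−1)·degC`.
THE OBSERVATION (analytic side of the dictionary). `χ_W = cubicNewvectorChar q` has norm one (`CartanSupply.NormOne.sum_sq_eq_card`,
`CartanSupply.char_inv`), so `𝓛 ⊗ ℝ` has a ONE-DIMENSIONAL COMMUTANT (Mathlib's `card_inv_mul_sum_char_mul_char_eq_finrank` through the tree's
`CartanSupply.VirtualCharacter.sum_char_mul_char_inv`), hence ANY TWO `G`-INVARIANT REAL FORMS ON `𝓛`, ONE POSITIVE DEFINITE, ARE PROPORTIONAL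
(`exists_smul_eq_of_invariant_forms`; the commuting matrix is `S⁻¹N`). Consequences for the geometric constructor of (F2b♮): the integral form
need not come from geometry (the averaged form `avgForm = Σ_g ⟨ρ(g)x, ρ(g)y⟩` will do); `c` is solved for from the non-split sheet count; the two sheet
counts collapse to ONE RATIO IDENTITY `S(u_S,u_S)·(q²−1)·degC = S(u_C,u_C)·(q−1)²·degX0` for ANY real invariant positive-definite `S` — in the
analytic dictionary the real part of the Petersson product on the full level-`q` cover, whose values on the torus-descended forms are «sheets ×
Petersson norm on the torus quotient» `= |T̄|·κ·deg·covol` [cite: CaiShuTian2014, p. 5 `(f,f)_U = deg f`]; [cite: Zagier1985].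
RESULTS: §1 real matrix model `realMat`/`realRep` and its character; §2 SCHUR (`finrank_intertwining_eq_one`, `exists_eq_smul_one_of_commute`);
§3 proportionality of invariant forms; §4 the averaged form (symmetric, invariant, positive) and real Gram matrices; §5 the norm-one input and the
RATIO TRANSFER (`ratio_transfer`; `q = 2` by rank one); §6 the constructor `exists_saturatedPre_of_realForm` and the THIN REAL-FORM DICTIONARY
`saturatedDictionary_of_realFormDictionary` ⟹ (F2b♮) (⟹ NUM, `CartanSaturatedDictionary.onePlaceLaw_of_saturatedDictionary`).
WHAT THE GEOMETRIC SIDE STILL OWES: `(d, ρ, tr ρ = χ_W)` [K-type multiplicity one + rank], `(𝓛∕3𝓛)^G = 0` [the Ihara-type input], a real invariant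
positive-definite `S` [Petersson], `u_S, u_C ∉ 3𝓛` torus-fixed [pull-backs of the class-minimal parametrisations; descent], the ratio identity [sheet
counts], `ord₃` of the two degrees. HONEST FRAMING: finite-group linear algebra only; (F2b♮) ∕ NUM ∕ 23422 ∕ 19109 are NOT proved; no route item,
no registered stub, no summit statement is proved; BSD is proved for no curve. [folklore]; [cite: SerreLinearRepresentations1977, §2.2–2.3].
-/

set_option linter.dupNamespace false
set_option autoImplicit false

noncomputable section

namespace Summit.BirchSwinnertonDyer.BirchSwinnertonDyer.Theorems.CartanSchurForm

open Summit.BirchSwinnertonDyer.BirchSwinnertonDyer.Theorems.CartanDegree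
open Summit.BirchSwinnertonDyer.BirchSwinnertonDyer.Theorems.CartanTorusCubeCut
open Summit.BirchSwinnertonDyer.BirchSwinnertonDyer.Theorems.CartanSupply
open Summit.BirchSwinnertonDyer.BirchSwinnertonDyer.Theorems.CartanSaturatedDictionary
open Summit.BirchSwinnertonDyer.BirchSwinnertonDyer.Theorems.CartanPreDatumOfLattice
open WeierstrassCurve Literature.NumberTheory.Automorphic Literature.NumberTheory.EllipticCurves.Rank1Residual
  Summit.BirchSwinnertonDyer.Rank1Residual
open Matrix
open scoped Classical

/-! ## §1 The real matrix model of an integral representation -/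
section realModel

variable {Γ : Type*} [Group Γ] {d : ℕ} (ρ : Representation ℤ Γ (Fin d → ℤ))

/-- The matrix of `ρ g` in the standard basis, with real entries. -/
def realMat (g : Γ) : Matrix (Fin d) (Fin d) ℝ :=
  (Int.castRingHom ℝ).mapMatrix (LinearMap.toMatrix' (ρ g))

/-- PROVED: `realMat` is multiplicative. [folklore] -/
theorem realMat_mul (g h : Γ) : realMat ρ (g * h) = realMat ρ g * realMat ρ h := by
  simp only [realMat, map_mul, LinearMap.toMatrix'_mul]

/-- PROVED: `realMat 1 = 1`. [folklore] -/
theorem realMat_one : realMat ρ 1 = 1 := by simp only [realMat, map_one, LinearMap.toMatrix'_one]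

/-- PROVED: `realMat g · realMat g⁻¹ = 1`. [folklore] -/
theorem realMat_mul_inv (g : Γ) : realMat ρ g * realMat ρ g⁻¹ = 1 := by rw [← realMat_mul, mul_inv_cancel, realMat_one]

/-- PROVED: the trace of `realMat g` is the integral trace of `ρ g`. [folklore] -/
theorem trace_realMat (g : Γ) : (realMat ρ g).trace = ((LinearMap.trace ℤ (Fin d → ℤ) (ρ g) : ℤ) : ℝ) := by
  rw [LinearMap.trace_eq_matrix_trace ℤ (Pi.basisFun ℤ (Fin d)), LinearMap.toMatrix_eq_toMatrix']
  simp [realMat, Matrix.trace, Matrix.map_apply]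

/-- The real representation `ρ ⊗ ℝ` on `ℝ^d` (standard basis). -/
def realRep : Representation ℝ Γ (Fin d → ℝ) where
  toFun g := Matrix.toLin' (realMat ρ g)
  map_one' := by rw [realMat_one, Matrix.toLin'_one]; rfl
  map_mul' g h := by rw [realMat_mul, Matrix.toLin'_mul]; rfl

/-- PROVED: `realRep g = toLin' (realMat g)`. [folklore] -/
theorem realRep_apply (g : Γ) : realRep ρ g = Matrix.toLin' (realMat ρ g) := rfl
/-- PROVED: the character of `ρ ⊗ ℝ` is the integral trace. [folklore] -/
theorem realRep_character (g : Γ) :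
    (realRep ρ).character g = ((LinearMap.trace ℤ (Fin d → ℤ) (ρ g) : ℤ) : ℝ) := by
  rw [← trace_realMat]
  show LinearMap.trace ℝ _ (Matrix.toLin' (realMat ρ g)) = _
  rw [LinearMap.trace_eq_matrix_trace ℝ (Pi.basisFun ℝ (Fin d)), LinearMap.toMatrix_eq_toMatrix', LinearMap.toMatrix'_toLin']

end realModel

/-! ## §2 Schur: a one-dimensional commutant from the norm-one identity -/
section schur

variable {Γ : Type*} [Group Γ] [Fintype Γ] {d : ℕ} (ρ : Representation ℤ Γ (Fin d → ℤ))

/-- PROVED — if `Σ_g tr ρ(g)·tr ρ(g⁻¹) = |Γ|` then `End_Γ(ρ ⊗ ℝ)` is one-dimensional (Mathlib's scalar-product formula, through the tree's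
`CartanSupply.VirtualCharacter.sum_char_mul_char_inv`). [folklore] -/
theorem finrank_intertwining_eq_one
    (hnorm : ∑ g : Γ, ((LinearMap.trace ℤ (Fin d → ℤ) (ρ g) : ℤ) : ℝ) * ((LinearMap.trace ℤ (Fin d → ℤ) (ρ g⁻¹) : ℤ) : ℝ)
      = Fintype.card Γ) :
    Module.finrank ℝ ((realRep ρ).IntertwiningMap (realRep ρ)) = 1 := by
  have h := VirtualCharacter.sum_char_mul_char_inv (realRep ρ) (realRep ρ)
  simp_rw [realRep_character] at h
  rw [hnorm] at h
  have hc : (Fintype.card Γ : ℝ) ≠ 0 := by exact_mod_cast Fintype.card_ne_zero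
  have h1 : (Module.finrank ℝ ((realRep ρ).IntertwiningMap (realRep ρ)) : ℝ) = 1 := by
    have h' : (Fintype.card Γ : ℝ) * (Module.finrank ℝ ((realRep ρ).IntertwiningMap (realRep ρ)) : ℝ) = Fintype.card Γ * 1 := by
      rw [mul_one]; exact h.symm
    exact mul_left_cancel₀ hc h'
  exact_mod_cast h1

/-- PROVED — **SCHUR**: under the norm-one identity, a real matrix commuting with all `ρ(g)` is a scalar. [folklore] -/
theorem exists_eq_smul_one_of_commute
    (hnorm : ∑ g : Γ, ((LinearMap.trace ℤ (Fin d → ℤ) (ρ g) : ℤ) : ℝ) * ((LinearMap.trace ℤ (Fin d → ℤ) (ρ g⁻¹) : ℤ) : ℝ)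
      = Fintype.card Γ)
    (A : Matrix (Fin d) (Fin d) ℝ) (hA : ∀ g, realMat ρ g * A = A * realMat ρ g) :
    ∃ ν : ℝ, A = ν • (1 : Matrix (Fin d) (Fin d) ℝ) := by
  rcases Nat.eq_zero_or_pos d with hd | hd
  · subst hd
    exact ⟨0, Subsingleton.elim _ _⟩
  haveI : Nonempty (Fin d) := ⟨⟨0, hd⟩⟩
  -- the intertwiner attached to a commuting matrix
  let T : ∀ M : Matrix (Fin d) (Fin d) ℝ, (∀ g, realMat ρ g * M = M * realMat ρ g) →
      (realRep ρ).IntertwiningMap (realRep ρ) := fun M hM =>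
    ⟨Matrix.toLin' M, fun g => by
      rw [realRep_apply, ← Matrix.toLin'_mul, ← Matrix.toLin'_mul, hM]⟩
  have hT : ∀ M hM, (T M hM).toLinearMap = Matrix.toLin' M := fun _ _ => rfl
  have h1c : ∀ g, realMat ρ g * 1 = 1 * realMat ρ g := fun g => by rw [Matrix.mul_one, Matrix.one_mul]
  have hT1 : T 1 h1c ≠ 0 := by
    intro h0
    have h' : (T 1 h1c).toLinearMap = (0 : (realRep ρ).IntertwiningMap (realRep ρ)).toLinearMap := by rw [h0]
    rw [hT 1 h1c] at h'
    have h'' : Matrix.toLin' (1 : Matrix (Fin d) (Fin d) ℝ) = Matrix.toLin' 0 := by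
      rw [h', map_zero]; rfl
    exact one_ne_zero (Matrix.toLin'.injective h'')
  obtain ⟨ν, hν⟩ := (finrank_eq_one_iff_of_nonzero' (T 1 h1c) hT1).mp (finrank_intertwining_eq_one ρ hnorm) (T A hA)
  refine ⟨ν, ?_⟩
  have h' := congrArg Representation.IntertwiningMap.toLinearMap hν
  rw [Representation.IntertwiningMap.toLinearMap_smul, hT 1 h1c, hT A hA, ← LinearEquiv.map_smul] at h'
  exact (Matrix.toLin'.injective h').symm

/-! ## §3 Any two invariant real forms, one positive definite, are proportional -/
/-- PROVED — **INVARIANT FORMS ARE PROPORTIONAL**: under the norm-one identity, if `S` is a positive-definite and `N` any real matrix with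
`ρ(g)ᵀ S ρ(g) = S`, `ρ(g)ᵀ N ρ(g) = N` for all `g`, then `N = μ·S`. (The commuting matrix is `S⁻¹N`.) [folklore] -/
theorem exists_smul_eq_of_invariant_forms
    (hnorm : ∑ g : Γ, ((LinearMap.trace ℤ (Fin d → ℤ) (ρ g) : ℤ) : ℝ) * ((LinearMap.trace ℤ (Fin d → ℤ) (ρ g⁻¹) : ℤ) : ℝ)
      = Fintype.card Γ)
    (S N : Matrix (Fin d) (Fin d) ℝ) (hS : S.PosDef)
    (hSinv : ∀ g, (realMat ρ g)ᵀ * S * realMat ρ g = S) (hNinv : ∀ g, (realMat ρ g)ᵀ * N * realMat ρ g = N) :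
    ∃ μ : ℝ, N = μ • S := by
  have hdet : IsUnit S.det := (Matrix.isUnit_iff_isUnit_det S).mp hS.isUnit
  have hS1 : S⁻¹ * S = 1 := Matrix.nonsing_inv_mul S hdet
  have hS2 : S * S⁻¹ = 1 := Matrix.mul_nonsing_inv S hdet
  have hTr : ∀ g, (realMat ρ g⁻¹)ᵀ * (realMat ρ g)ᵀ = 1 := fun g => by
    rw [← Matrix.transpose_mul, realMat_mul_inv, Matrix.transpose_one]
  -- `X ρ(g) = ρ(g⁻¹)ᵀ X` for every invariant `X`
  have hXR : ∀ X : Matrix (Fin d) (Fin d) ℝ, (∀ g, (realMat ρ g)ᵀ * X * realMat ρ g = X) →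
      ∀ g, X * realMat ρ g = (realMat ρ g⁻¹)ᵀ * X := fun X hX g => by
    calc X * realMat ρ g = ((realMat ρ g⁻¹)ᵀ * (realMat ρ g)ᵀ) * X * realMat ρ g := by rw [hTr, Matrix.one_mul]
      _ = (realMat ρ g⁻¹)ᵀ * ((realMat ρ g)ᵀ * X * realMat ρ g) := by simp only [Matrix.mul_assoc]
      _ = (realMat ρ g⁻¹)ᵀ * X := by rw [hX]
  have hcomm : ∀ g, realMat ρ g * (S⁻¹ * N) = (S⁻¹ * N) * realMat ρ g := fun g => by
    have h1 : realMat ρ g * S⁻¹ = S⁻¹ * (realMat ρ g⁻¹)ᵀ := by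
      calc realMat ρ g * S⁻¹ = S⁻¹ * S * realMat ρ g * S⁻¹ := by rw [hS1, Matrix.one_mul]
        _ = S⁻¹ * (S * realMat ρ g) * S⁻¹ := by simp only [Matrix.mul_assoc]
        _ = S⁻¹ * ((realMat ρ g⁻¹)ᵀ * S) * S⁻¹ := by rw [hXR S hSinv]
        _ = S⁻¹ * (realMat ρ g⁻¹)ᵀ * (S * S⁻¹) := by simp only [Matrix.mul_assoc]
        _ = S⁻¹ * (realMat ρ g⁻¹)ᵀ := by rw [hS2, Matrix.mul_one]
    calc realMat ρ g * (S⁻¹ * N) = (realMat ρ g * S⁻¹) * N := by rw [Matrix.mul_assoc]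
      _ = S⁻¹ * ((realMat ρ g⁻¹)ᵀ * N) := by rw [h1, Matrix.mul_assoc]
      _ = S⁻¹ * (N * realMat ρ g) := by rw [hXR N hNinv]
      _ = S⁻¹ * N * realMat ρ g := by rw [Matrix.mul_assoc]
  obtain ⟨μ, hμ⟩ := exists_eq_smul_one_of_commute ρ hnorm (S⁻¹ * N) hcomm
  refine ⟨μ, ?_⟩
  calc N = S * (S⁻¹ * N) := by rw [← Matrix.mul_assoc, hS2, Matrix.one_mul]
    _ = S * (μ • (1 : Matrix (Fin d) (Fin d) ℝ)) := by rw [hμ]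
    _ = μ • S := by rw [Matrix.mul_smul, Matrix.mul_one]

end schur

/-! ## §4 The averaged form -/
section avg

variable {Γ : Type*} [Group Γ] [Fintype Γ] {d : ℕ} (ρ : Representation ℤ Γ (Fin d → ℤ))

/-- The AVERAGED STANDARD FORM `Σ_g ⟨ρ(g)x, ρ(g)y⟩`: an integral, symmetric, `Γ`-invariant, positive-definite form on `ℤ^d`
attached to any integral representation of a finite group. -/
def avgForm : (Fin d → ℤ) →ₗ[ℤ] (Fin d → ℤ) →ₗ[ℤ] ℤ :=
  LinearMap.mk₂ ℤ (fun x y => ∑ g : Γ, ρ g x ⬝ᵥ ρ g y)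
    (fun x x' y => by simp only [map_add, add_dotProduct, Finset.sum_add_distrib])
    (fun c x y => by simp only [map_smul, smul_dotProduct, Finset.smul_sum])
    (fun x y y' => by simp only [map_add, dotProduct_add, Finset.sum_add_distrib])
    (fun c x y => by simp only [map_smul, dotProduct_smul, Finset.smul_sum])

/-- PROVED: the formula. [folklore] -/
theorem avgForm_apply (x y : Fin d → ℤ) : avgForm ρ x y = ∑ g : Γ, ρ g x ⬝ᵥ ρ g y := rfl

/-- PROVED: symmetry. [folklore] -/
theorem avgForm_symm (x y : Fin d → ℤ) : avgForm ρ x y = avgForm ρ y x := by simp only [avgForm_apply, dotProduct_comm]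

/-- PROVED: invariance (reindex the sum by right multiplication). [folklore] -/
theorem avgForm_inv (h : Γ) (x y : Fin d → ℤ) : avgForm ρ (ρ h x) (ρ h y) = avgForm ρ x y := by
  simp only [avgForm_apply]
  have hmul : ∀ g, ρ g (ρ h x) ⬝ᵥ ρ g (ρ h y) = ρ (g * h) x ⬝ᵥ ρ (g * h) y := fun g => by
    rw [map_mul]; rfl
  simp_rw [hmul]
  exact Fintype.sum_equiv (Equiv.mulRight h) _ _ (fun g => rfl)

/-- PROVED: positivity. [folklore] -/
theorem avgForm_pos (x : Fin d → ℤ) (hx : x ≠ 0) : 0 < avgForm ρ x x := by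
  rw [avgForm_apply]
  have hnn : ∀ g ∈ (Finset.univ : Finset Γ), 0 ≤ ρ g x ⬝ᵥ ρ g x := fun g _ => by
    have := dotProduct_star_self_nonneg (ρ g x)
    rwa [star_trivial] at this
  have h1 : 0 < ρ 1 x ⬝ᵥ ρ 1 x := by
    rw [map_one]
    show 0 < x ⬝ᵥ x
    have := dotProduct_star_self_pos_iff.mpr hx
    rwa [star_trivial] at this
  exact Finset.sum_pos' hnn ⟨1, Finset.mem_univ _, h1⟩

omit [Fintype Γ] in
/-- PROVED: the real Gram matrix of an invariant integral form is invariant in matrix terms. [folklore] -/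
theorem realGram_invariant (B : (Fin d → ℤ) →ₗ[ℤ] (Fin d → ℤ) →ₗ[ℤ] ℤ) (hB : ∀ g x y, B (ρ g x) (ρ g y) = B x y) (g : Γ) :
    (realMat ρ g)ᵀ * (Int.castRingHom ℝ).mapMatrix (LinearMap.toMatrix₂' ℤ B) * realMat ρ g
      = (Int.castRingHom ℝ).mapMatrix (LinearMap.toMatrix₂' ℤ B) := by
  have hc : B.compl₁₂ (ρ g) (ρ g) = B := by
    apply LinearMap.ext; intro x; apply LinearMap.ext; intro y
    rw [LinearMap.compl₁₂_apply, hB]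
  have hZ : (LinearMap.toMatrix' (ρ g))ᵀ * LinearMap.toMatrix₂' ℤ B * LinearMap.toMatrix' (ρ g) = LinearMap.toMatrix₂' ℤ B := by
    rw [← LinearMap.toMatrix₂'_compl₁₂, hc]
  have h := congrArg (Int.castRingHom ℝ).mapMatrix hZ
  rw [map_mul, map_mul] at h
  simp only [RingHom.mapMatrix_apply, Matrix.transpose_map] at h
  simpa only [realMat, RingHom.mapMatrix_apply] using h

/-- PROVED: the value `B u u` read off the real Gram matrix. [folklore] -/
theorem realGram_quad (B : (Fin d → ℤ) →ₗ[ℤ] (Fin d → ℤ) →ₗ[ℤ] ℤ) (u v : Fin d → ℤ) :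
    (fun i => (u i : ℝ)) ⬝ᵥ ((Int.castRingHom ℝ).mapMatrix (LinearMap.toMatrix₂' ℤ B) *ᵥ fun i => (v i : ℝ)) = ((B u v : ℤ) : ℝ) := by
  have h1 : B u v = u ⬝ᵥ (LinearMap.toMatrix₂' ℤ B *ᵥ v) := by
    conv_lhs => rw [← Matrix.toLinearMap₂'_toMatrix' (R := ℤ) B]
    rw [Matrix.toLinearMap₂'_apply']
  rw [h1]
  show _ = (Int.castRingHom ℝ) (u ⬝ᵥ (LinearMap.toMatrix₂' ℤ B *ᵥ v))
  rw [RingHom.map_dotProduct]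
  congr 1
  funext i
  rw [Function.comp_apply, RingHom.map_mulVec]
  rfl

end avg

/-! ## §5 The norm-one input for `χ_W` and the ratio transfer -/
section ratio

variable {q : ℕ} [Fact q.Prime]

/-- PROVED — the norm-one identity `Σ_g tr ρ(g)·tr ρ(g⁻¹) = |GL₂(𝔽_q)|` for an integral representation with character `χ_W`, `q ∉ {2,3}`
(`CartanSupply.NormOne.sum_sq_eq_card`, `CartanSupply.char_inv`). [folklore] -/
theorem norm_one_of_trace_eq (hq3 : q ≠ 3) (hq2 : q ≠ 2) {d : ℕ} (ρ : Representation ℤ (G q) (Fin d → ℤ))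
    (trace_eq : ∀ g, LinearMap.trace ℤ (Fin d → ℤ) (ρ g) = cubicNewvectorChar q g) :
    ∑ g : G q, ((LinearMap.trace ℤ (Fin d → ℤ) (ρ g) : ℤ) : ℝ) * ((LinearMap.trace ℤ (Fin d → ℤ) (ρ g⁻¹) : ℤ) : ℝ)
      = Fintype.card (G q) := by
  simp_rw [trace_eq, char_inv]
  have h := NormOne.sum_sq_eq_card hq3 hq2
  have h' : ((∑ g : G q, cubicNewvectorChar q g ^ 2 : ℤ) : ℝ) = ((Fintype.card (G q) : ℤ) : ℝ) := by rw [h]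
  push_cast at h'
  simp_rw [sq] at h'
  exact h'

/-- PROVED — **THE RATIO TRANSFER**: for an integral representation with character `χ_W` (`q ≠ 3`), an invariant integral form `B` positive
on a vector `u_C ≠ 0`, and a real invariant positive-definite form `S`, the ratio identity for `S` implies the ratio identity for `B`:
`S(u_S,u_S)·a = S(u_C,u_C)·b ⟹ B(u_S,u_S)·a = B(u_C,u_C)·b` (`q ≠ 2`: Schur; `q = 2`: rank one). [folklore] -/
theorem ratio_transfer (hq3 : q ≠ 3) {d : ℕ} (ρ : Representation ℤ (G q) (Fin d → ℤ))
    (trace_eq : ∀ g, LinearMap.trace ℤ (Fin d → ℤ) (ρ g) = cubicNewvectorChar q g)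
    (B : (Fin d → ℤ) →ₗ[ℤ] (Fin d → ℤ) →ₗ[ℤ] ℤ) (hB : ∀ g x y, B (ρ g x) (ρ g y) = B x y)
    (S : Matrix (Fin d) (Fin d) ℝ) (hS : S.PosDef) (hSinv : ∀ g, (realMat ρ g)ᵀ * S * realMat ρ g = S)
    (uS uC : Fin d → ℤ) (huC : 0 < B uC uC) (a b : ℝ)
    (hratio : ((fun i => (uS i : ℝ)) ⬝ᵥ (S *ᵥ fun i => (uS i : ℝ))) * a = ((fun i => (uC i : ℝ)) ⬝ᵥ (S *ᵥ fun i => (uC i : ℝ))) * b) :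
    ((B uS uS : ℤ) : ℝ) * a = ((B uC uC : ℤ) : ℝ) * b := by
  -- the real Gram matrix of `B`
  set N : Matrix (Fin d) (Fin d) ℝ := (Int.castRingHom ℝ).mapMatrix (LinearMap.toMatrix₂' ℤ B) with hN
  have hNinv : ∀ g, (realMat ρ g)ᵀ * N * realMat ρ g = N := realGram_invariant ρ B hB
  have hqS := realGram_quad B uS uS
  have hqC := realGram_quad B uC uC
  rw [← hN] at hqS hqC
  -- proportionality `N = μ • S`
  have hprop : ∃ μ : ℝ, N = μ • S := by
    by_cases hq2 : q = 2
    · -- rank one: `d = 1`, all `1 × 1` matrices are proportional to the positive `S`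
      subst hq2
      have hd : d = 1 := by
        have h := trace_eq 1
        rw [map_one, LinearMap.trace_one, Module.finrank_fin_fun, cubicNewvectorChar_two_one] at h
        exact_mod_cast h
      subst hd
      have hS00 : 0 < S 0 0 := by
        have h := hS.dotProduct_mulVec_pos (x := fun _ => (1 : ℝ)) (by
          intro h0; have := congrFun h0 0; simp at this)
        simpa [dotProduct, mulVec, Fin.sum_univ_one] using h
      refine ⟨N 0 0 / S 0 0, ?_⟩
      ext i j
      have hi : i = 0 := Subsingleton.elim _ _
      have hj : j = 0 := Subsingleton.elim _ _
      subst hi hj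
      rw [Matrix.smul_apply, smul_eq_mul, div_mul_cancel₀ _ hS00.ne']
    · exact exists_smul_eq_of_invariant_forms ρ (norm_one_of_trace_eq hq3 hq2 ρ trace_eq) S N hS hSinv hNinv
  obtain ⟨μ, hμ⟩ := hprop
  have hvals : ∀ u : Fin d → ℤ, (fun i => (u i : ℝ)) ⬝ᵥ (N *ᵥ fun i => (u i : ℝ)) = μ * ((fun i => (u i : ℝ)) ⬝ᵥ (S *ᵥ fun i => (u i : ℝ))) :=
    fun u => by rw [hμ, Matrix.smul_mulVec, dotProduct_smul, smul_eq_mul]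
  rw [← hqS, ← hqC, hvals, hvals, mul_assoc, mul_assoc, hratio]

end ratio

/-! ## §6 The B-free, c-free constructor and the thin real-form dictionary -/
section constructor

variable {q : ℕ} [Fact q.Prime]

/-- PROVED — **A SATURATED PRE-DATUM FROM A LATTICE WITHOUT FORM, A REAL INVARIANT POSITIVE FORM AND ONE RATIO IDENTITY** (`q ≠ 3`):
given `(d, ρ)` with `tr ρ = χ_W` and `(𝓛∕3𝓛)^G = 0`, an elliptic `η`, a real positive-definite `S` with `ρ(g)ᵀ S ρ(g) = S`, torus-fixed vectors
`u_S, u_C` not divisible by `3`, positive degrees with `S(u_S,u_S)·(q²−1)·degC = S(u_C,u_C)·(q−1)²·degX0`, there is a saturated pre-datum with these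
degrees. The integral form is the averaged form and `c` is solved for; everything else is tam3-p1's `exists_saturatedPre_of_lattice`. [folklore] -/
theorem exists_saturatedPre_of_realForm (hq3 : q ≠ 3) {d : ℕ} (ρ : Representation ℤ (G q) (Fin d → ℤ))
    (trace_eq : ∀ g, LinearMap.trace ℤ (Fin d → ℤ) (ρ g) = cubicNewvectorChar q g)
    (noFixed : ∀ v : Fin d → ℤ, (∀ g, ∃ w : Fin d → ℤ, ρ g v - v = (3 : ℤ) • w) → ∃ w : Fin d → ℤ, v = (3 : ℤ) • w)
    (η : Mat q) (hη : ¬ HasRatEigenvalue η)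
    (S : Matrix (Fin d) (Fin d) ℝ) (hS : S.PosDef) (hSinv : ∀ g, (realMat ρ g)ᵀ * S * realMat ρ g = S)
    (uS uC : Fin d → ℤ)
    (huS : ∀ g : G q, (g : Mat q) 0 1 = 0 → (g : Mat q) 1 0 = 0 → ρ g uS = uS)
    (huC : ∀ g : G q, (g : Mat q) * η = η * g → ρ g uC = uC)
    (h3S : ¬ ∃ v : Fin d → ℤ, uS = (3 : ℤ) • v) (h3C : ¬ ∃ v : Fin d → ℤ, uC = (3 : ℤ) • v)
    (degX0 degC : ℕ) (hX0 : 0 < degX0) (hC0 : 0 < degC)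
    (sheet : ((fun i => (uS i : ℝ)) ⬝ᵥ (S *ᵥ fun i => (uS i : ℝ))) * (((q : ℝ) ^ 2 - 1) * degC)
      = ((fun i => (uC i : ℝ)) ⬝ᵥ (S *ᵥ fun i => (uC i : ℝ))) * (((q : ℝ) - 1) ^ 2 * degX0)) :
    ∃ 𝒟 : CartanTorusDegreeDataPre q, (q % 3 = 1 → 𝒟.SatThree) ∧ 𝒟.degX0 = degX0 ∧ 𝒟.degC = degC := by
  -- the lattice with the averaged form
  let 𝓛 : CartanTorusLattice q :=
    { d := d, ρ := ρ, trace_eq := trace_eq, B := avgForm ρ, B_symm := avgForm_symm ρ, B_pos := avgForm_pos ρ, B_inv := avgForm_inv ρ,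
      noFixedVectorModThree := noFixed, η := η, η_irred := hη }
  have huC0 : uC ≠ 0 := by rintro rfl; exact h3C ⟨0, by simp⟩
  have hBC : 0 < avgForm ρ uC uC := avgForm_pos ρ uC huC0
  -- the ratio identity for the averaged form (Schur)
  have hratioR : ((avgForm ρ uS uS : ℤ) : ℝ) * (((q : ℝ) ^ 2 - 1) * degC) = ((avgForm ρ uC uC : ℤ) : ℝ) * (((q : ℝ) - 1) ^ 2 * degX0) :=
    ratio_transfer hq3 ρ trace_eq (avgForm ρ) (avgForm_inv ρ) S hS hSinv uS uC hBC _ _ sheet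
  have hratio : ((avgForm ρ uS uS : ℤ) : ℚ) * (((q : ℚ) ^ 2 - 1) * degC) = ((avgForm ρ uC uC : ℤ) : ℚ) * (((q : ℚ) - 1) ^ 2 * degX0) := by
    have h' : ((((avgForm ρ uS uS : ℤ) : ℚ) * (((q : ℚ) ^ 2 - 1) * degC) : ℚ) : ℝ)
        = ((((avgForm ρ uC uC : ℤ) : ℚ) * (((q : ℚ) - 1) ^ 2 * degX0) : ℚ) : ℝ) := by
      push_cast; exact hratioR
    exact_mod_cast h'
  -- solve for `c` from the non-split sheet count
  have hq1 : (1 : ℚ) < q := by exact_mod_cast (Fact.out : q.Prime).one_lt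
  have hBCq : (0 : ℚ) < ((avgForm ρ uC uC : ℤ) : ℚ) := by exact_mod_cast hBC
  have hdegC : (0 : ℚ) < (degC : ℚ) := by exact_mod_cast hC0
  set c : ℚ := ((q : ℚ) ^ 2 - 1) / 2 * (degC : ℚ) / ((avgForm ρ uC uC : ℤ) : ℚ) with hc
  have hq21 : (0 : ℚ) < (q : ℚ) ^ 2 - 1 := by nlinarith
  have hcpos : 0 < c := by rw [hc]; positivity
  have sheet_C : c * ((𝓛.B uC uC : ℤ) : ℚ) = ((q : ℚ) ^ 2 - 1) / 2 * (degC : ℚ) := by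
    show c * ((avgForm ρ uC uC : ℤ) : ℚ) = _
    rw [hc, div_mul_cancel₀ _ hBCq.ne']
  have sheet_s : c * ((𝓛.B uS uS : ℤ) : ℚ) = ((q : ℚ) - 1) ^ 2 / 2 * (degX0 : ℚ) := by
    show c * ((avgForm ρ uS uS : ℤ) : ℚ) = _
    rw [hc]
    field_simp
    linear_combination hratio
  exact exists_saturatedPre_of_lattice hq3 𝓛 c hcpos uS uC huS huC h3S h3C degX0 degC hX0 hC0 sheet_s sheet_C

/-- PROVED — **THE THIN REAL-FORM DICTIONARY ⟹ (F2b♮)**: if at every Cartan place (binders VERBATIM those of (F2b♮)) the geometric side delivers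
an integral `GL₂(𝔽_q)`-representation with character `χ_W` and no fixed vector mod `3`, an elliptic `η`, a REAL invariant positive-definite form
`S` (no integrality, no normalisation), torus-fixed vectors `u_S, u_C ∉ 3𝓛`, positive `degX0, degC` with the ONE ratio identity
`S(u_S,u_S)(q²−1)degC = S(u_C,u_C)(q−1)²degX0` and `ord₃ degX0 = ord₃ Q'.deg`, `ord₃ degC = ord₃ Q.deg`, then (F2b♮) holds (hence NUM). [folklore] -/
theorem saturatedDictionary_of_realFormDictionary
    (h : ∀ (V : WeierstrassCurve ℚ) [V.IsElliptic] [V.IsGloballyMinimal], ClassX11b V 3 → Surj V 3 →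
      ∀ (N D M : ℕ) (C : Finset ℕ) (q : ℕ) [Fact q.Prime]
        (X : CartanLevelCurveData D M C) (W₁ : WeierstrassCurve ℚ) [W₁.IsElliptic] (Q : CartanParametrizationData X W₁)
        (X' : CartanLevelCurveData D (M * q ^ 2) (C.erase q)) (W₂ : WeierstrassCurve ℚ) [W₂.IsElliptic]
        (Q' : CartanParametrizationData X' W₂),
        V.conductorNorm ℤ = N → D * M * ∏ p ∈ C, p ^ 2 = N → q ∈ C → q ≠ 3 → ¬ q ^ 3 ∣ N →
        3 ∣ (V.baseChange ℚ_[q]).localTamagawaNumber ℤ_[q] →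
        Q.IsMinimalFor V → Q'.IsMinimalFor V →
        ∃ (d : ℕ) (ρ : Representation ℤ (G q) (Fin d → ℤ)) (η : Mat q) (S : Matrix (Fin d) (Fin d) ℝ)
          (uS uC : Fin d → ℤ) (degX0 degC : ℕ),
          (∀ g, LinearMap.trace ℤ (Fin d → ℤ) (ρ g) = cubicNewvectorChar q g) ∧
          (∀ v : Fin d → ℤ, (∀ g, ∃ w : Fin d → ℤ, ρ g v - v = (3 : ℤ) • w) → ∃ w : Fin d → ℤ, v = (3 : ℤ) • w) ∧
          ¬ HasRatEigenvalue η ∧ S.PosDef ∧ (∀ g, (realMat ρ g)ᵀ * S * realMat ρ g = S) ∧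
          (∀ g : G q, (g : Mat q) 0 1 = 0 → (g : Mat q) 1 0 = 0 → ρ g uS = uS) ∧
          (∀ g : G q, (g : Mat q) * η = η * g → ρ g uC = uC) ∧
          (¬ ∃ v : Fin d → ℤ, uS = (3 : ℤ) • v) ∧ (¬ ∃ v : Fin d → ℤ, uC = (3 : ℤ) • v) ∧ 0 < degX0 ∧ 0 < degC ∧
          ((fun i => (uS i : ℝ)) ⬝ᵥ (S *ᵥ fun i => (uS i : ℝ))) * (((q : ℝ) ^ 2 - 1) * degC)
            = ((fun i => (uC i : ℝ)) ⬝ᵥ (S *ᵥ fun i => (uC i : ℝ))) * (((q : ℝ) - 1) ^ 2 * degX0) ∧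
          padicValNat 3 degX0 = padicValNat 3 Q'.deg ∧ padicValNat 3 degC = padicValNat 3 Q.deg) :
    CartanHomLatticeSaturatedDictionaryAtThree := by
  intro V _ _ hX hS N D M C q _ X W₁ _ Q X' W₂ _ Q' hN hDMC hq hq3 hq3N hc hQ hQ'
  obtain ⟨d, ρ, η, S, uS, uC, degX0, degC, htr, hnf, hη, hSpd, hSinv, huS, huC, h3S, h3C, hX0, hC0, hsheet, hv1, hv2⟩ :=
    h V hX hS N D M C q X W₁ Q X' W₂ Q' hN hDMC hq hq3 hq3N hc hQ hQ'
  obtain ⟨𝒟, hsat, h1, h2⟩ :=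
    exists_saturatedPre_of_realForm hq3 ρ htr hnf η hη S hSpd hSinv uS uC huS huC h3S h3C degX0 degC hX0 hC0 hsheet
  exact ⟨𝒟, hsat, by rw [h1]; exact hv1, by rw [h2]; exact hv2⟩

end constructor

end Summit.BirchSwinnertonDyer.BirchSwinnertonDyer.Theorems.CartanSchurForm
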